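import Summits.BirchSwinnertonDyer.BirchSwinnertonDyer.Theorems.PrintCf2DisegniPairTwoChiLinePointwise
import Summits.BirchSwinnertonDyer.Rank1Residual.Additive.PowerMapRigidity
import Literature.NumberTheory.EllipticCurves.PAdicPowerSeriesRecenterProofs
import Literature.NumberTheory.EllipticCurves.PAdicPowerSeriesInterpolationAgreementProofs
import Literature.NumberTheory.EllipticCurves.CyclotomicInterpolantUniquenessProofs
import Literature.NumberTheory.EllipticCurves.PAdicBSDMemIwasawaRatProofs
import HarnessLib

/-!
# Road (C) `disegni-pair-two` on crux stmt-BirchSwinnertonDyer-20368 — STEP B₂(2): the FACTORISATION of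
# Disegni's `2`-adic Rankin–Selberg function on the `χ₈ ∘ N`-line through the REFLECTED Mazur–Tate–Teitelbaum
# functions: `G(T) = c · L₂(E, −T−2) · L₂(E^{(d_K)}, −T−2)`

Cell `bsd-print-cf2`, width seat `bsd-line-cf2-p1-w8` g21; fourth file of the `p = 2` factorisation chain
(`…ChiLineValues`, `…ChiLineValuesTwo`, `…ChiLinePointwise`). THEOREMS ONLY (no `def`, no named fact, no
`sorry`); `--supports stmt-BirchSwinnertonDyer-20368`. BSD is not proved by any of this; no summit
statement is claimed. This is the theorem the cell planner asked for (PREGRADE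
`bsd-print-cf2-plan/PREGRADE-disegni-pair-two-skeleton-g24.md` §5, 2026-08-30T17:46:42Z: «Disegni's line
function on the χ-line of (V_{d′}, χ = ε_{d*}∘N_{E′}) interpolates … = "L(W,χ^s)·L(W^{(E′)},χ^s)", so
ord₂ G′χ(0) = D + a … state this factorisation as its own stub/lemma (the addord cluster treats the
analogous 𝟙-line factorisation as a THEOREM to prove, not a print)»), in the branch `d* = 2`
(`ε₂ = χ₈` EVEN; the odd branches `d* = −1, −2` have no Mazur–Tate–Teitelbaum object in the tree, whose
measures carry the plus modular symbol only).

## Statement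

`E = V/ℚ` globally minimal, GOOD ORDINARY at `2`, with newform `f` and unit root `α = unitRoot V 2`;
`K` quadratic with `(2, d_K) = 1` (so `2` unramified) and `2` SPLIT, `𝔭, 𝔭′ ∋ 2`, Kronecker character
`κ` (hypotheses verbatim as in `rankinSelbergEulerProductHecke_baseChangeDirichlet_eq`); `V′` globally
minimal, good ordinary at `2`, `a₂(V′) = a₂(V)`, with newform `f′`, `a_n(f′) = κ(n)a_n(f)` (the twist
`E^{(d_K)}`); `G` Disegni's bounded function on the line through `χ = χ₈∘N_{K/ℚ}` for `(f, a = ι(α))`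
(`Disegni2017.ChiLineInterpolation`, typer (U5a′) p779517); `L₂(E,T) = padicLFunction f α`,
`L₂(E′,T) = padicLFunction f′ α ∈ ℚ₂⟦T⟧` (Mazur–Tate–Teitelbaum); `c = ι⁻¹(u·Car·Ω⁺_f·Ω⁺_{f′})`,
`u = 16/3`. Then:

* `chi8Line_eq_C_mul_map` — **`G = c · H♯`** where `H ∈ ℚ₂⟦T⟧` is the re-centring of
  `P := L₂(E,T)·L₂(E′,T)` at `−2` reflected, i.e. `H(z) = P(−2−z)` on the open disc, `H(0) = P(−2)`,
  `H′(0) = −P′(−2)` (`exists_recenter_sub`, p782122) and `H♯` its image in `ℂ₂⟦T⟧`;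
* `hasLineValueAt_chi8Line` — **`G(z) = c · L₂(E, −2−z) · L₂(E′, −2−z)`** for every `z ∈ ℂ₂`, `‖z‖ < 1`;
* `constantCoeff_chi8Line_eq` — `G(0) = c · L₂(E, −2) · L₂(E′, −2)`;
* `coeff_one_chi8Line_eq` — `[T¹]G = −c · Σ_k k·P_k·(−2)^{k−1}` (`= −c·P′(−2)`), the exact form of the
  planner's «ord₂ G′_χ(0) = D + a» once `L₂(E, −2) = 0` (rank-one sign; the Leibniz split
  `P′(−2) = L₂′(E,−2)·L₂(E′,−2)` is the sibling file `…ChiLineLeadingCoeff`).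

## Proof

`D := G − c·H♯ ∈ ℂ₂⟦T⟧` has bounded coefficients (`IsLineFunction`; `‖H_j‖ ≤ C_P`), and vanishes at
every point `χ(γ) − 1` of the uniqueness principle `eq_zero_of_bounded_of_forall_character_hasSum_zero`
(ALL even primitive `2`-power-order `χ` mod `2^m`, `m ≥ 1`, and the constant term): such a `χ` is the twin
of a complex `θ` (`exists_eq_twin_of_isOfFinOrder`); `θ` mod `2` or mod `4` cannot be primitive and even
(`dirichletCharacter_level_two_eq_one`, `not_isPrimitive_of_even_level_four`); `θ` mod `8` is `χ₈`, the
point `T = −2`, where `G(−2) = c·L₂(E,0)·L₂(E′,0)` (`hasLineValueAt_chi8Line_neg_two`, the UNRAMIFIED point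
of the line: Euler factors `(1−α⁻¹)²` twice) while `H(−2) = P(0)`; `θ` mod `2^{m+1} ≥ 16` gives
`G(pt θ) = c·v_ξ(f)·v_ξ(f′)` (`hasLineValueAt_chi8Line_of_three_le`) with `v_ξ(g)` the MTT value at the
twin of `ξ = θχ₈`, i.e. at `−pt θ − 2` (`cycLinePoint_mul_chi8`,
`hasSum_coeff_padicLFunction_unitRoot`, `MemIwasawaRat.hasSum_eval_mul`), while `H(pt θ) = P(−2 − pt θ)`;
and the constant term: `G(0) = c·v₈(f)v₈(f′)` (`hasLineValueAt_chi8Line_zero`), the MTT values at the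
conductor-`8` character, `T = −2`, while `H(0) = P(−2)`.

References: [Disegni2017] Thm. A, Lemma 10.2.1–10.2.2 (arXiv v3 PDF pp. 6–8, 68); [MazurTateTeitelbaum1986Invent]
§I.11–I.14; [PerrinRiou1987] (1.1) p. 459 (the `p`-adic Artin formalism on the cyclotomic line);
[Gross2004] §3, §13; [Robert2000] Ch. 6 §1.5 (re-centring); cell PREGRADE §5.
-/

set_option autoImplicit false
set_option linter.dupNamespace false

noncomputable section

open scoped Classical MatrixGroups ModularForm NumberField

open CongruenceSubgroup NumberField IsDedekindDomain WeierstrassCurve Literature.NumberTheory.EllipticCurves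
  Literature.NumberTheory.EllipticCurves.ModularForms
  Literature.NumberTheory.EllipticCurves.Disegni2017 Literature.NumberTheory.GaloisRepresentations
  Summit.BirchSwinnertonDyer.Rank1Residual.Additive

namespace Summit.BirchSwinnertonDyer.BirchSwinnertonDyer.Theorems.PrintCf2.DisegniPairTwo

section Factorisation

variable (ι : PadicAlgCl 2 ≃+* ℂ) (K : Type) [Field K] [NumberField K] [IsGalois ℚ K]

/-- `‖−2‖₂ = 1/2 < 1` in `ℚ₂`. [folklore] -/
private theorem norm_neg_two_lt_one : ‖(-2 : ℚ_[2])‖ < 1 := by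
  rw [norm_neg, show (2 : ℚ_[2]) = ((2 : ℕ) : ℚ_[2]) by norm_num, Padic.norm_p]
  norm_num

/-- `ι₂(−2) = −2`. [folklore] -/
private theorem algebraMap_neg_two : algebraMap ℚ_[2] ℂ_[2] (-2) = -2 := by
  rw [map_neg, map_ofNat]

/-- Curves with the same `a₂` have the same unit root at `2`. [cite: MazurTateTeitelbaum1986Invent, §I.11] -/
private theorem unitRoot_eq_of_frobeniusTrace_eq' {V V' : WeierstrassCurve ℚ} [V.IsGloballyMinimal]
    [V'.IsGloballyMinimal] (h : V'.frobeniusTrace 2 = V.frobeniusTrace 2) :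
    unitRoot V' 2 = unitRoot V 2 := by
  unfold unitRoot
  rw [h]

/-- ★★★ **FACTORISATION of Disegni's `2`-adic Rankin–Selberg function on the `χ₈∘N`-line** (`d* = 2`
branch of road (C)). With the notation of the module docstring: there is `H ∈ ℚ₂⟦T⟧` with
(i) `G = c · H♯` in `ℂ₂⟦T⟧`; (ii) `H(0) = Σ_k P_k(−2)^k = P(−2)`; (iii) `[T¹]H = −Σ_k k·P_k·(−2)^{k−1} =
−P′(−2)`; (iv) `Σ_j H_j z^j = Σ_k P_k(−2−z)^k` for all `z ∈ ℂ₂`, `‖z‖ < 1` — where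
`P = L₂(E,T)·L₂(E′,T) = padicLFunction f α · padicLFunction f′ α`. That is,
**`G(T) = c · L₂(E, −T−2) · L₂(E′, −T−2)`**: Disegni's function on the line through `χ₈∘N` is, up to the
unit-free constant `c = ι⁻¹(u·Car·Ω⁺_f·Ω⁺_{f′})`, the product of the two Mazur–Tate–Teitelbaum `2`-adic
`L`-functions of `E` and of its twist `E^{(d_K)}` read on the `χ₈`-COSET `T ↦ −T−2` of the cyclotomic
variable (`(χ₈θ)(5) − 1 = −(θ(5)−1) − 2`). Proof: uniqueness of bounded interpolants over `ℂ₂`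
(`eq_zero_of_bounded_of_forall_character_hasSum_zero`) applied to `G − c·H♯`, which vanishes at every
typed point by STEP B₂(1) + the MTT interpolation theorems + `cycLinePoint_mul_chi8`.
[cite: Disegni2017, Theorem A and Lemma 10.2.1–10.2.2 (arXiv v3 PDF pp. 6–8, 68)]
[cite: MazurTateTeitelbaum1986Invent, §I.11–I.14] [cite: PerrinRiou1987, (1.1) (p. 459)] -/
theorem chi8Line_eq_C_mul_map (h2 : Module.finrank ℚ K = 2)
    (hsplit : ((Ideal.span {(2 : ℤ)}).primesOver (𝓞 K)).ncard = 2)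
    (𝔭 𝔭' : HeightOneSpectrum (𝓞 K)) (h𝔭 : ((2 : ℕ) : 𝓞 K) ∈ 𝔭.asIdeal)
    (h𝔭' : ((2 : ℕ) : 𝓞 K) ∈ 𝔭'.asIdeal)
    (κ : DirichletCharacter ℂ (NumberField.discr K).natAbs)
    (hκ : ∀ ℓ : ℕ, ℓ.Prime → ℓ ≠ 2 → κ ℓ = (jacobiSym (NumberField.discr K) ℓ : ℂ))
    (hκ2 : κ 2 = if NumberField.discr K % 8 = 1 then 1
        else if NumberField.discr K % 8 = 5 then -1 else 0)
    (hd : Nat.Coprime 2 (NumberField.discr K).natAbs)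
    (V V' : WeierstrassCurve ℚ) [V.IsElliptic] [V.IsGloballyMinimal] [V'.IsElliptic] [V'.IsGloballyMinimal]
    (hordV : IsOrdinaryAt V 2) (hordV' : IsOrdinaryAt V' 2) (hap : V'.frobeniusTrace 2 = V.frobeniusTrace 2)
    {N N' : ℕ} [NeZero N] [NeZero N'] (hN : ¬ 2 ∣ N) {f : CuspForm (Gamma0 N) 2}
    {f' : CuspForm (Gamma0 N') 2} (hfV : IsNewformOf V f) (hfV' : IsNewformOf V' f')
    (hV' : ∀ n : ℕ, cuspCoeff f' n = κ (n : ZMod _) * cuspCoeff f n)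
    {Car : ℝ} {G : PowerSeries ℂ_[2]}
    (hG : ChiLineInterpolation ι K f (ι (((unitRoot V 2 : ℚ_[2]) : PadicAlgCl 2)))
      (baseChangeDirichlet K (ZMod.χ₈.ringHomComp (Int.castRingHom ℂ))) 𝔭 𝔭' Car G) :
    ∃ H : PowerSeries ℚ_[2],
      G = PowerSeries.C
          (((ι.symm ((splitLocalConstant 2 : ℂ) * (Car : ℂ) * (plusPeriod f : ℂ) * (plusPeriod f' : ℂ)) :
              PadicAlgCl 2) : ℂ_[2])) * PowerSeries.map (algebraMap ℚ_[2] ℂ_[2]) H ∧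
      HasSum (fun k : ℕ ↦ PowerSeries.coeff k
          (padicLFunction f (unitRoot V 2 : ℚ_[2]) * padicLFunction f' (unitRoot V 2 : ℚ_[2])) *
            (-2) ^ k) (PowerSeries.coeff 0 H) ∧
      HasSum (fun k : ℕ ↦ -(PowerSeries.coeff k
          (padicLFunction f (unitRoot V 2 : ℚ_[2]) * padicLFunction f' (unitRoot V 2 : ℚ_[2])) *
            (k : ℚ_[2]) * (-2) ^ (k - 1))) (PowerSeries.coeff 1 H) ∧
      ∀ z : ℂ_[2], ‖z‖ < 1 →
        HasSum (fun j : ℕ ↦ algebraMap ℚ_[2] ℂ_[2] (PowerSeries.coeff j H) * z ^ j)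
          (∑' k : ℕ, algebraMap ℚ_[2] ℂ_[2] (PowerSeries.coeff k
            (padicLFunction f (unitRoot V 2 : ℚ_[2]) * padicLFunction f' (unitRoot V 2 : ℚ_[2]))) *
              (-2 - z) ^ k) := by
  -- notation
  set α : ℚ_[2] := (unitRoot V 2 : ℚ_[2]) with hαdef
  have hα' : (unitRoot V' 2 : ℚ_[2]) = α := by rw [hαdef, unitRoot_eq_of_frobeniusTrace_eq' hap]
  have hαn : ‖α‖ = 1 := by
    rw [hαdef, ← PadicInt.norm_def]
    exact PadicInt.isUnit_iff.mp (unitRoot_spec_holds V 2 hordV).2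
  set c : ℂ_[2] := ((ι.symm ((splitLocalConstant 2 : ℂ) * (Car : ℂ) * (plusPeriod f : ℂ) *
    (plusPeriod f' : ℂ)) : PadicAlgCl 2) : ℂ_[2]) with hc
  set B₁ := padicLFunction f α with hB₁
  set B₂ := padicLFunction f' α with hB₂
  set ι₂ := algebraMap ℚ_[2] ℂ_[2] with hι₂
  have hf : IsNewform0 f := hfV.1
  have hQ : coeffField f = ⊥ := hfV.coeffField_eq_bot
  have hf' : IsNewform0 f' := hfV'.1
  have hQ' : coeffField f' = ⊥ := hfV'.coeffField_eq_bot
  -- boundedness of the two MTT functions and of their product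
  obtain ⟨C₁, hC₁⟩ := exists_forall_norm_coeff_padicLFunction_le (f := f) hordV hfV
  obtain ⟨C₂, hC₂⟩ := exists_forall_norm_coeff_padicLFunction_le (f := f') hordV' hfV'
  rw [hα'] at hC₂
  have hM₁ : MemIwasawaRat 2 B₁ := memIwasawaRat_of_forall_norm_coeff_le hC₁
  have hM₂ : MemIwasawaRat 2 B₂ := memIwasawaRat_of_forall_norm_coeff_le hC₂
  have hMP : MemIwasawaRat 2 (B₁ * B₂) := memIwasawaRat_mul hM₁ hM₂
  obtain ⟨CP, hCP⟩ := hMP.exists_norm_coeff_le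
  -- the re-centred product `H(T) = P(−2 − T)`
  obtain ⟨H, hHb, hH0, hH1, hHev⟩ := exists_recenter_sub hCP norm_neg_two_lt_one
  refine ⟨H, ?_, hH0, hH1, fun z hz ↦ ?_⟩
  swap
  · have h := (hHev z hz).2
    rwa [algebraMap_neg_two] at h
  -- `D := G − c·H♯`
  obtain ⟨CG, hCG⟩ := hG.isLineFunction.1
  set D : PowerSeries ℂ_[2] := G - PowerSeries.C c * PowerSeries.map ι₂ H with hD
  have hDcoeff : ∀ i, PowerSeries.coeff i D = PowerSeries.coeff i G - c * ι₂ (PowerSeries.coeff i H) := by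
    intro i
    rw [hD, map_sub, PowerSeries.coeff_C_mul, PowerSeries.coeff_map]
  -- evaluation of `D` from evaluations of `G` and `H♯`
  have hDsum : ∀ (z vG vH : ℂ_[2]), HasSum (fun i ↦ PowerSeries.coeff i G * z ^ i) vG →
      HasSum (fun i ↦ ι₂ (PowerSeries.coeff i H) * z ^ i) vH →
      HasSum (fun i ↦ PowerSeries.coeff i D * z ^ i) (vG - c * vH) := by
    intro z vG vH hG' hH'
    have h := hG'.sub (hH'.mul_left c)
    refine h.congr_fun fun i ↦ ?_
    rw [hDcoeff, sub_mul, mul_assoc]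
  -- boundedness of `D`
  have hDb : ∀ i, ‖(RingHom.id ℂ_[2]) (PowerSeries.coeff i D)‖ ≤ CG + ‖c‖ * CP := by
    intro i
    rw [RingHom.id_apply, hDcoeff]
    refine (norm_sub_le _ _).trans (add_le_add (hCG i) ?_)
    rw [norm_mul, hι₂, norm_algebraMap']
    exact mul_le_mul_of_nonneg_left (hHb i) (norm_nonneg _)
  -- MTT interpolation values: at the trivial character and at a twin
  have hB10 : PowerSeries.constantCoeff B₁ = (1 - α⁻¹) ^ 2 * (ratPlusSymbol f 0 : ℚ_[2]) :=
    constantCoeff_padicLFunction_unitRoot hordV hfV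
  have hB20 : PowerSeries.constantCoeff B₂ = (1 - α⁻¹) ^ 2 * (ratPlusSymbol f' 0 : ℚ_[2]) := by
    have h := constantCoeff_padicLFunction_unitRoot hordV' hfV'
    rwa [hα'] at h
  have hMTT₁ : ∀ {n : ℕ} (hn : 0 < n) (χ : DirichletCharacter ℂ_[2] (2 ^ n)), χ.IsPrimitive → χ.Even →
      (∃ j : ℕ, orderOf χ = 2 ^ j) →
      HasSum (fun k ↦ ι₂ (PowerSeries.coeff k B₁) * (χ (cyclotomicGenerator 2 : ZMod (2 ^ n)) - 1) ^ k)
        (ι₂ (α⁻¹ ^ n) * ratTwistedSymbolSum f χ) :=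
    fun hn χ hχ heven hord ↦ hasSum_coeff_padicLFunction_unitRoot hordV hfV hn χ hχ heven hord
  have hMTT₂ : ∀ {n : ℕ} (hn : 0 < n) (χ : DirichletCharacter ℂ_[2] (2 ^ n)), χ.IsPrimitive → χ.Even →
      (∃ j : ℕ, orderOf χ = 2 ^ j) →
      HasSum (fun k ↦ ι₂ (PowerSeries.coeff k B₂) * (χ (cyclotomicGenerator 2 : ZMod (2 ^ n)) - 1) ^ k)
        (ι₂ (α⁻¹ ^ n) * ratTwistedSymbolSum f' χ) := by
    intro n hn χ hχ heven hord
    have h := hasSum_coeff_padicLFunction_unitRoot hordV' hfV' hn χ hχ heven hord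
    rwa [hα'] at h
  -- the value of `H♯` at a point `z`: the product of the two MTT values at `−2 − z`
  have hHval : ∀ {z v₁ v₂ : ℂ_[2]}, ‖z‖ < 1 →
      HasSum (fun k ↦ ι₂ (PowerSeries.coeff k B₁) * (-2 - z) ^ k) v₁ →
      HasSum (fun k ↦ ι₂ (PowerSeries.coeff k B₂) * (-2 - z) ^ k) v₂ →
      HasSum (fun i ↦ ι₂ (PowerSeries.coeff i H) * z ^ i) (v₁ * v₂) := by
    intro z v₁ v₂ hz hv₁ hv₂
    have hw : ‖(-2 - z : ℂ_[2])‖ < 1 := by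
      rw [← algebraMap_neg_two, sub_eq_add_neg]
      refine lt_of_le_of_lt (IsUltrametricDist.norm_add_le_max _ _) (max_lt ?_ (by rwa [norm_neg]))
      rw [norm_algebraMap']; exact norm_neg_two_lt_one
    have hprod := MemIwasawaRat.hasSum_eval_mul hM₁ hM₂ hw hv₁ hv₂
    have h := (hHev z hz).2
    rw [algebraMap_neg_two, hprod.tsum_eq] at h
    exact h
  -- (a) the constant term: `G(0) = c·v₈·v₈′ = c·H(0)`
  haveI : NeZero (2 ^ 3) := ⟨by norm_num⟩
  set χ₈₃ : DirichletCharacter ℂ (2 ^ 3) := ZMod.χ₈.ringHomComp (Int.castRingHom ℂ) with hχ₈₃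
  set ψ₈ : DirichletCharacter ℂ_[2] (2 ^ 3) :=
    (χ₈₃⁻¹.ringHomComp ι.symm.toRingHom).ringHomComp (algebraMap (PadicAlgCl 2) ℂ_[2]) with hψ₈
  have hpt8 : ψ₈ (cyclotomicGenerator 2 : ZMod (2 ^ 3)) - 1 = -2 := by
    rw [hψ₈, twin_apply_cyclotomicGenerator_sub_one ι (m := 2) χ₈₃, hχ₈₃, cycLinePoint_chi8]
  have h0 : PowerSeries.constantCoeff D = 0 := by
    have hG0 := hasLineValueAt_chi8Line_zero ι K h2 hsplit 𝔭 𝔭' h𝔭 h𝔭' κ hκ hκ2 hd hf hQ hf' hQ' hV' α hG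
    -- the twin of `χ₈` is an even primitive character of order `2` at the point `−2`
    have hprim : DirichletCharacter.IsPrimitive ψ₈ :=
      (twin_isPrimitive_iff ι χ₈₃).mpr (isPrimitive_χ₈_ringHomComp_of_charZero ℂ)
    have heven : DirichletCharacter.Even ψ₈ := (twin_even_iff ι χ₈₃).mpr chi8_even
    have hord : ∃ j : ℕ, orderOf ψ₈ = 2 ^ j := by
      rw [hψ₈, orderOf_twin]; exact exists_orderOf_eq_two_pow χ₈₃
    have hv₁ := hMTT₁ (n := 3) (by norm_num) ψ₈ hprim heven hord
    have hv₂ := hMTT₂ (n := 3) (by norm_num) ψ₈ hprim heven hord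
    rw [hpt8] at hv₁ hv₂
    have hv₁' : HasSum (fun k ↦ ι₂ (PowerSeries.coeff k B₁) * (-2 - (0 : ℂ_[2])) ^ k)
        (ι₂ (α⁻¹ ^ 3) * ratTwistedSymbolSum f ψ₈) := by simpa only [sub_zero] using hv₁
    have hv₂' : HasSum (fun k ↦ ι₂ (PowerSeries.coeff k B₂) * (-2 - (0 : ℂ_[2])) ^ k)
        (ι₂ (α⁻¹ ^ 3) * ratTwistedSymbolSum f' ψ₈) := by simpa only [sub_zero] using hv₂
    have hz0 : ‖(0 : ℂ_[2])‖ < 1 := by rw [norm_zero]; exact one_pos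
    have hH' := hHval hz0 hv₁' hv₂'
    have hD0 := hDsum 0 _ _ hG0 hH'
    rw [mul_assoc c, sub_self] at hD0
    exact (HasLineValueAt.eq_constantCoeff hD0).symm
  -- (b) the characters of `Γ`
  have hchar : ∀ m : ℕ, 0 < m → ∀ χ : DirichletCharacter ℂ_[2] (2 ^ m), χ.IsPrimitive → χ.Even →
      (∃ j : ℕ, orderOf χ = 2 ^ j) →
        HasSum (fun i ↦ (RingHom.id ℂ_[2]) (PowerSeries.coeff i D) *
          (χ (cyclotomicGenerator 2 : ZMod (2 ^ m)) - 1) ^ i) 0 := by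
    intro m hm χ hχ heven hord
    simp only [RingHom.id_apply]
    obtain ⟨m', rfl⟩ := Nat.exists_eq_succ_of_ne_zero hm.ne'
    have hfin : IsOfFinOrder χ := by
      obtain ⟨j, hj⟩ := hord
      exact orderOf_pos_iff.mp (by rw [hj]; exact pow_pos two_pos j)
    obtain ⟨θ, rfl⟩ := exists_eq_twin_of_isOfFinOrder ι χ hfin
    have hθprim : θ.IsPrimitive := (twin_isPrimitive_iff ι θ).mp hχ
    have hθeven : θ.Even := (twin_even_iff ι θ).mp heven
    rw [twin_apply_cyclotomicGenerator_sub_one ι θ]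
    rcases Nat.lt_or_ge m' 3 with hlt | hge
    · interval_cases m'
      · -- level `2`: no primitive character
        exfalso
        rw [dirichletCharacter_level_two_eq_one θ, DirichletCharacter.isPrimitive_def,
          DirichletCharacter.conductor_one] at hθprim
        norm_num at hθprim
      · -- level `4`: no even primitive character
        exact absurd hθprim (not_isPrimitive_of_even_level_four θ hθeven)
      · -- level `8`: `θ = χ₈`, the point `T = −2`; `H(−2) = P(0)`
        have hθχ : θ = χ₈₃ := eq_chi8_of_even_of_isPrimitive θ hθeven hθprim
        subst hθχ
        rw [cycLinePoint_chi8]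
        have hG2 := hasLineValueAt_chi8Line_neg_two ι K h2 𝔭 𝔭' κ hκ hκ2 hN hf hQ hf' hQ' hV' hαn hG
        -- the two MTT functions at `−2 − (−2) = 0`: their constant terms
        have hz2 : ‖(-2 : ℂ_[2])‖ < 1 := by
          rw [← algebraMap_neg_two, norm_algebraMap']; exact norm_neg_two_lt_one
        have hB₁0 : HasSum (fun k ↦ ι₂ (PowerSeries.coeff k B₁) * (-2 - (-2 : ℂ_[2])) ^ k)
            (ι₂ ((1 - α⁻¹) ^ 2 * (ratPlusSymbol f 0 : ℚ_[2]))) := by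
          rw [sub_neg_eq_add, neg_add_cancel, ← hB10, ← PowerSeries.coeff_zero_eq_constantCoeff]
          have h : HasSum (fun k ↦ ι₂ (PowerSeries.coeff k B₁) * (0 : ℂ_[2]) ^ k)
              (ι₂ (PowerSeries.coeff 0 B₁) * (0 : ℂ_[2]) ^ 0) :=
            hasSum_single 0 fun k hk ↦ by rw [zero_pow hk, mul_zero]
          rwa [pow_zero, mul_one] at h
        have hB₂0 : HasSum (fun k ↦ ι₂ (PowerSeries.coeff k B₂) * (-2 - (-2 : ℂ_[2])) ^ k)
            (ι₂ ((1 - α⁻¹) ^ 2 * (ratPlusSymbol f' 0 : ℚ_[2]))) := by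
          rw [sub_neg_eq_add, neg_add_cancel, ← hB20, ← PowerSeries.coeff_zero_eq_constantCoeff]
          have h : HasSum (fun k ↦ ι₂ (PowerSeries.coeff k B₂) * (0 : ℂ_[2]) ^ k)
              (ι₂ (PowerSeries.coeff 0 B₂) * (0 : ℂ_[2]) ^ 0) :=
            hasSum_single 0 fun k hk ↦ by rw [zero_pow hk, mul_zero]
          rwa [pow_zero, mul_one] at h
        have hH' := hHval hz2 hB₁0 hB₂0
        have hD2 := hDsum (-2) _ _ hG2 hH'
        rwa [mul_assoc c, sub_self] at hD2
    · -- level `2^{m'+1} ≥ 16`: `ξ = θχ₈`, `G(pt θ) = c·v·v′`, `H(pt θ) = P(−pt θ − 2) = v·v′`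
      have h8 : 8 ∣ 2 ^ (m' + 1) := by
        rw [show (8 : ℕ) = 2 ^ 3 by norm_num]; exact pow_dvd_pow 2 (by omega)
      set ξ := θ * DirichletCharacter.changeLevel h8 (ZMod.χ₈.ringHomComp (Int.castRingHom ℂ)) with hξ
      have hGθ := hasLineValueAt_chi8Line_of_three_le ι K h2 hsplit 𝔭 𝔭' h𝔭 h𝔭' κ hκ hκ2 hd hf hQ hf'
        hQ' hV' α hG hge h8 hθeven hθprim
      -- MTT at the twin of `ξ`, whose point is `−pt θ − 2`
      set ψ : DirichletCharacter ℂ_[2] (2 ^ (m' + 1)) :=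
        (ξ⁻¹.ringHomComp ι.symm.toRingHom).ringHomComp (algebraMap (PadicAlgCl 2) ℂ_[2]) with hψ
      have hξprim : DirichletCharacter.IsPrimitive ψ :=
        (twin_isPrimitive_iff ι ξ).mpr (isPrimitive_mul_chi8_changeLevel hge h8 hθprim)
      have hξeven : DirichletCharacter.Even ψ := (twin_even_iff ι ξ).mpr (even_mul_chi8_changeLevel h8 hθeven)
      have hξord : ∃ j : ℕ, orderOf ψ = 2 ^ j := by
        rw [hψ, orderOf_twin]; exact exists_orderOf_eq_two_pow ξ
      have hptξ : ψ (cyclotomicGenerator 2 : ZMod (2 ^ (m' + 1))) - 1 = -2 - cycLinePoint ι θ := by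
        rw [hψ, twin_apply_cyclotomicGenerator_sub_one ι ξ, hξ, cycLinePoint_mul_chi8 ι h8 θ]
        ring
      have hv₁ := hMTT₁ (Nat.succ_pos m') ψ hξprim hξeven hξord
      have hv₂ := hMTT₂ (Nat.succ_pos m') ψ hξprim hξeven hξord
      rw [hptξ] at hv₁ hv₂
      have hzθ : ‖cycLinePoint ι θ‖ < 1 := by
        rw [← twin_apply_cyclotomicGenerator_sub_one ι θ]
        exact norm_apply_cyclotomicGenerator_sub_one_lt _ hord
      have hH' := hHval hzθ hv₁ hv₂
      have hDθ := hDsum _ _ _ hGθ hH'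
      rwa [mul_assoc c, sub_self] at hDθ
  -- uniqueness
  have hD0 : D = 0 :=
    eq_zero_of_bounded_of_forall_character_hasSum_zero (RingHom.id ℂ_[2]) (fun _ _ h ↦ h) hDb h0 hchar
  rw [hD, sub_eq_zero] at hD0
  exact hD0

end Factorisation

end Summit.BirchSwinnertonDyer.BirchSwinnertonDyer.Theorems.PrintCf2.DisegniPairTwo

end
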